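import Summits.KontsevichZagierPeriods.Zeta5Search.WedgeDictionaryGroupTransport
import HarnessLib

/-!
# ζ(5) search — `explicitPQ` transports along the fifth generator `i₁` (slots `(14)(23)(57)`)

HONEST FRAMING: systematic search; no irrationality claim unless certified.

Cell `pub-zeta5`, gen-1 (seat g17).  `WedgeDictionaryGroupTransport` proves the abstract transport `explicitPQAt_transport` of the
wedge-dictionary identity `explicitPQ` along any map `g` with `b(g a) = σ • b(a)` and `I/∏_F h!` invariant, and instantiates it at the
four generators `p₀₁ = (34)`, `p₁₂ = (35)`, `h = (36)`, `h' = (46)` of the Brown–Zudilin group (arXiv:2210.03391, Sect. 7).  The fifth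
generator `i₁` acts on the dual coordinates by the slot involution `σ = (14)(23)(57)` (`bOfA_genI1`, file `WedgeDictionaryDescent22Mirror`,
already in the import closure) and PRESERVES the convergence cone (`converges_genI1`), so its instance needs no convergence side
condition.  With it the transport is available along all five generators, which generate the full slot group `S₇`
(`CellularGroup.closure_eq_top`); consequence used by the gen-1 terminal-template programme (memo `pub-zeta5-gen-1/D2-TERMINAL-g17.md`):
below the top (`2·max_j b_j ≤ b₀`) every slot permutation of a region point is a region point, so a terminal face template may be
proved at ANY placement of its zero set and carried to the other placements — 7 families `k = |S| ∈ {0,…,6}` instead of 39 classes.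
-/

namespace Summit.KontsevichZagierPeriods.Zeta5Search.WedgeDictionary

open Literature.NumberTheory.Irrationality.BrownZudilin2022

/-- **`explicitPQ` transports along `i₁`** (slots `1 ↔ 4`, `2 ↔ 3`, `5 ↔ 7`): from partner `j = σ(i)+1` at `a` to partner `i+1` at
`i₁ a`, given the hypotheses of `explicitPQ` at `a` and the cited invariance (27) (`invariance_of_converges'`, clause `i₁`);
convergence at `i₁ a` is automatic (`converges_genI1`). -/
theorem explicitPQAt_genI1 (hInv : invariance_of_converges') {a : Fin 8 → ℤ} (i : Fin 7) {j : ℕ}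
    (hj : j = (slotPermI1 i).val + 1) (hr : RegionHyp a j) (h : ExplicitPQAt a j) :
    ExplicitPQAt (genI1 a) (i.val + 1) :=
  have hc : Converges (genI1 a) := converges_genI1 hr.2.1
  explicitPQAt_transport (bOfA_genI1 a) ((hInv a hr.2.1).1 hc) i hj hr (regionHyp_transport (bOfA_genI1 a) hc i hj hr) h

/-- The same with an explicit convergence witness at `i₁ a` (uniform shape with `explicitPQAt_genP01/P12/H/Hp`). -/
theorem explicitPQAt_genI1' (hInv : invariance_of_converges') {a : Fin 8 → ℤ} (i : Fin 7) {j : ℕ}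
    (hj : j = (slotPermI1 i).val + 1) (hr : RegionHyp a j) (hc : Converges (genI1 a)) (h : ExplicitPQAt a j) :
    ExplicitPQAt (genI1 a) (i.val + 1) :=
  explicitPQAt_transport (bOfA_genI1 a) ((hInv a hr.2.1).1 hc) i hj hr (regionHyp_transport (bOfA_genI1 a) hc i hj hr) h

/-- Region hypotheses are `i₁`-stable (no side condition). -/
theorem regionHyp_genI1 {a : Fin 8 → ℤ} (i : Fin 7) {j : ℕ} (hj : j = (slotPermI1 i).val + 1) (hr : RegionHyp a j) :
    RegionHyp (genI1 a) (i.val + 1) :=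
  regionHyp_transport (bOfA_genI1 a) (converges_genI1 hr.2.1) i hj hr

end Summit.KontsevichZagierPeriods.Zeta5Search.WedgeDictionary
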